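import Mathlib
import Summits.ResolutionOfSingularities.ResolutionOfSingularities.Theorems.RadicialJungCleanModelsCleanProp44SolvableFace
import Summits.ResolutionOfSingularities.ResolutionOfSingularities.Theorems.RadicialJungCleanModelsCleanProp44BirthCountCurve
import HarnessLib

/-!
# Route `RadicialJung`, crux `CleanModels` (stmt-ResolutionOfSingularities-15917), line `Sketch` rev 35, stub 6 `stub_cleanProp44` (X44c):
# THE BIRTH COUNT ON THE SUCCESSOR `Γ″` ASSEMBLED — solvable face ⟹ `Γ″ = V(u₁, t_δ + λ(u))`, `deg λ ≤ δ`, and `Σ(ν − 1)[κ(c′):κ] ≤ δ − 2` (recipe steps (3) + (5))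

Seat decomp-res-hand-2 g21 (structural hand).  COMPOSITION of the g20 bricks ✓ `…SolvableFace` (`natDegree_le_of_solvableFace`), ✓ `…FaceDegree`
(`natDegree_derivative_le_sub_two`) and ✓ `…BirthCountCurve` (`sum_mul_natDegree_le_of_sub_pow_mem(_localization)`) into the ONE statement the termination
author consumes at the bottom of the leaf tower (memo 4e §2.5–2.6, g20 memo §0 ASSEMBLY RECIPE (3) + (5)):

* `pow_dvd_of_pow_dvd_algebraMap` — **divisibility descends from a localization**: `π` prime in a domain `R`, `S = M⁻¹R` with `π ∤ m` for `m ∈ M`,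
  `π^n ∣ Φ` in `S` ⟹ `π^n ∣ Φ` in `R`.  (The face `Φ` is a polynomial on the chart `E ∩ {u₁ ≠ ∞} ≅ 𝔸²_{κ(c)}` of the last exceptional divisor; «the
  transform keeps order `μ` along `Γ″`» is read in the local ring of ONE point of `Γ″` (or at its generic point) and descends to `κ(c)[u][T]`.)
* `exists_successor_of_solvableFace` — the face `Φ ∈ κ[u][T]` (`deg_T Φ ≤ μ`, top coefficient a non-zero constant `c`, `deg_u Φ_0 ≤ μ·d`) with a non-unit `π`,
  `π^μ ∣ Φ`, and `p ∣ d`: `π = a·(T + λ)`, `Φ = c·(T + λ)^μ`, `deg λ ≤ d`, `deg λ′ ≤ d − 2`.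
* `sum_mul_natDegree_le_of_restriction` — **THE COUNT THROUGH A RESTRICTION MAP**: `φ : O → κ[u]` killing the ideal `K` of `Γ″`, `φ U = a₀·λ` (`a₀ ≠ 0`: the
  restricted unit `U|_{Γ″} = −v(c)·λ`, recipe step (4)), `deg λ ≤ d`, `p ∣ d`, `λ′ ≠ 0`; birth orders measured upstairs `U − c_i^p ∈ K + q_i^{e_i+1}` at pairwise
  distinct closed points `P_i` (`φ q_i ⊆ (P_i)`): `Σ_i e_i·deg P_i ≤ d − 2`; `…_localization` — the same with denominators (birth orders in the local rings at
  maximal `q_i`).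
* `births_on_successor_le` — **ALL AT ONCE**: from the face data, `∃ a λ`, `π = a(T + λ)`, `Φ = c(T + λ)^μ`, `deg λ ≤ d`, and for EVERY restriction map with
  `φ U = a₀·λ` and every finite family of obstruction points as above: `λ′ ≠ 0 → Σ_i e_i·deg P_i ≤ d − 2`.
* `exists_eq_pow_of_restriction_of_derivative_eq_zero` — the complementary case over a PERFECT residue field: `λ′ = 0` ⟹ `a₀·λ = G^p` is a `p`-th power on the
  nose («`Γ″` is `W`-invariant: NO birth», memo §2.5); the imperfect corner `λ′ = 0`, `a₀λ ∉ κ[u]^p` is (B5′) (✓ `…ConstantTypeBirthWitness`).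

Honest framing: OURS, assembly of landed bricks; the scheme-level identification of `Φ`, `π`, `φ`, `U` with the tower data (census (S)) is NOT done here; nothing
here proves X44c, any case of `CleanModels`, or resolution of singularities in characteristic `p`.
[cite: CossartPiltant2008, Lemma 4.3 (4)–(5); Prop. 4.4 (proof, p. 11)] [cite: CossartPiltant2009, ch.1 II.5.3.2 (i)] [cite: CossartJannsenSaito2020, Lemma 7.5]
-/

noncomputable section

set_option linter.dupNamespace false -- mandated namespace of this single-conjunct summit

open Polynomial

namespace Summit.ResolutionOfSingularities.ResolutionOfSingularities.Theorems.RadicialJung.CleanModels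

/-! ## §1 Divisibility by a prime power descends from a localization -/

/-- **`π^n ∣ Φ` in a localization `M⁻¹R` at which `π` stays a non-unit ⟹ `π^n ∣ Φ` in `R`** (`R` a domain, `π` prime, `π ∤ m` for all `m ∈ M`).
[folklore] -/
theorem pow_dvd_of_pow_dvd_algebraMap {R S : Type*} [CommRing R] [IsDomain R] [CommRing S] [Algebra R S] (M : Submonoid R)
    [IsLocalization M S] (hM : M ≤ nonZeroDivisors R) {π : R} (hπ : Prime π) (hπM : ∀ m ∈ M, ¬ π ∣ m) {Φ : R} {n : ℕ}
    (h : (algebraMap R S π) ^ n ∣ algebraMap R S Φ) : π ^ n ∣ Φ := by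
  obtain ⟨s, hs⟩ := h
  obtain ⟨⟨a, m⟩, hsm⟩ := IsLocalization.surj M s
  -- `Φ·m = π^n·a` in `R`
  have h1 : algebraMap R S (Φ * m) = algebraMap R S (π ^ n * a) := by
    rw [map_mul, map_mul, map_pow, hs, mul_assoc, hsm]
  have h2 : Φ * m = π ^ n * a := IsLocalization.injective S hM h1
  have h3 : π ^ n ∣ Φ * m := ⟨a, h2⟩
  exact hπ.pow_dvd_of_dvd_mul_right n (hπM m m.2) h3

/-! ## §2 The successor line and its degree bounds -/

variable {k : Type*} [Field k]

/-- **The successor of a solvable face** (recipe step (3)): `Φ ∈ κ[u][T]`, `deg_T Φ ≤ μ` (`μ ≥ 1`), top coefficient the non-zero constant `c`,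
`deg_u Φ_0 ≤ μ·d`, `π` a non-unit with `π^μ ∣ Φ`, `(d : κ) = 0` ⟹ `π = a·(T + λ(u))`, `Φ = c·(T + λ)^μ`, `deg λ ≤ d`, `deg λ′ ≤ d − 2`.
[cite: CossartPiltant2008, Lemma 4.3 (5); Prop. 4.4 (proof, p. 11)] -/
theorem exists_successor_of_solvableFace {Φ π : (k[X])[X]} {μ : ℕ} (hμ : 1 ≤ μ) (hdeg : Φ.natDegree ≤ μ) {c : k} (hc : c ≠ 0)
    (htop : Φ.coeff μ = C c) (hπ : ¬ IsUnit π) (hdvd : π ^ μ ∣ Φ) {d : ℕ} (hC0 : (Φ.coeff 0).natDegree ≤ μ * d)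
    (hd : (d : k) = 0) :
    ∃ (a : k) (lam : k[X]), a ≠ 0 ∧ π = C (C a) * (X + C lam) ∧ Φ = C (C c) * (X + C lam) ^ μ ∧ lam.natDegree ≤ d ∧
      (derivative lam).natDegree ≤ d - 2 := by
  obtain ⟨a, lam, ha, hπeq, hΦ, hlam⟩ := natDegree_le_of_solvableFace hμ hdeg hc htop hπ hdvd hC0
  exact ⟨a, lam, ha, hπeq, hΦ, hlam, natDegree_derivative_le_sub_two hlam hd⟩

/-! ## §3 The count through a restriction map -/

section Count

variable (p : ℕ) [hp : Fact p.Prime] [CharP k p] {O : Type*} [CommRing O] (φ : O →+* k[X]) (K : Ideal O)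

/-- The derivative of the restricted unit `a₀·λ` is `a₀·λ′`, non-zero when `a₀ ≠ 0` and `λ′ ≠ 0`. [folklore] -/
theorem derivative'_C_mul_ne_zero {a₀ : k} (ha₀ : a₀ ≠ 0) {lam : k[X]} (hlam : derivative lam ≠ 0) :
    (derivative' : Derivation k k[X] k[X]) (C a₀ * lam) ≠ 0 := by
  show derivative (C a₀ * lam) ≠ 0
  rw [derivative_C_mul]
  exact mul_ne_zero (by rwa [Ne, C_eq_zero]) hlam

/-- `deg (a₀·λ)′ ≤ d − 2` for `deg λ ≤ d`, `p ∣ d`, `a₀ ≠ 0`. [folklore] -/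
theorem natDegree_derivative'_C_mul_le {a₀ : k} (ha₀ : a₀ ≠ 0) {lam : k[X]} {d : ℕ} (hdeg : lam.natDegree ≤ d) (hd : (d : k) = 0) :
    ((derivative' : Derivation k k[X] k[X]) (C a₀ * lam)).natDegree ≤ d - 2 := by
  show (derivative (C a₀ * lam)).natDegree ≤ d - 2
  rw [derivative_C_mul, natDegree_C_mul ha₀]
  exact natDegree_derivative_le_sub_two hdeg hd

/-- **THE BIRTH COUNT ON `Γ″` THROUGH A RESTRICTION MAP** (memo 4e §2.5–2.6 «`Σ_{births c′} (ν(c′) − 1)·[κ(c′):κ(c)] ≤ deg λ′ ≤ δ − 2`», every residue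
field outside the corner `λ′ ≡ 0`).  `φ : O → κ[u]` with `φ K = 0` (`K` the ideal of `Γ″` in the chart ring `O` upstairs), `φ U = a₀·λ` (the restricted unit;
`a₀ = −v(c) ≠ 0`), `deg λ ≤ d`, `(d : κ) = 0`, `λ′ ≠ 0`; pairwise distinct closed points `(P_i)` (primes of `κ[u]`) under ideals `q_i` (`φ q_i ⊆ (P_i)`) with birth
orders measured upstairs, `U − c_i^p ∈ K + q_i^{e_i+1}` («`ν(c′_i) ≥ e_i + 1`»).  Then `Σ_i e_i·deg P_i ≤ d − 2`.
[cite: CossartPiltant2008, Prop. 4.4 (proof, p. 11)] [cite: CossartPiltant2009, ch.1 II.5.3.2 (i)] -/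
theorem sum_mul_natDegree_le_of_restriction (hK : ∀ x ∈ K, φ x = 0) {U : O} {a₀ : k} (ha₀ : a₀ ≠ 0) {lam : k[X]} (hU : φ U = C a₀ * lam)
    {d : ℕ} (hdeg : lam.natDegree ≤ d) (hd : (d : k) = 0) (hlam : derivative lam ≠ 0)
    {ι : Type*} (s : Finset ι) (q : ι → Ideal O) (P : ι → k[X]) (e : ι → ℕ)
    (hP : ∀ i ∈ s, Prime (P i)) (hne : ∀ i ∈ s, ∀ j ∈ s, i ≠ j → ¬ P i ∣ P j) (hqP : ∀ i ∈ s, ∀ x ∈ q i, φ x ∈ Ideal.span {P i})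
    (h : ∀ i ∈ s, ∃ c : O, U - c ^ p ∈ K ⊔ q i ^ (e i + 1)) :
    ∑ i ∈ s, e i * (P i).natDegree ≤ d - 2 := by
  have hDF : (derivative' : Derivation k k[X] k[X]) (φ U) ≠ 0 := by
    rw [hU]; exact derivative'_C_mul_ne_zero ha₀ hlam
  refine (sum_mul_natDegree_le_of_sub_pow_mem p φ K hK _ hDF s q P e hP hne hqP h).trans ?_
  rw [hU]
  exact natDegree_derivative'_C_mul_le ha₀ hdeg hd

/-- **The same with denominators** (birth orders measured in the local rings `O_i` at the maximal ideals `q_i`, as the stalk statements of hand-2 g18–g20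
produce them). [cite: CossartPiltant2008, Prop. 4.4 (proof, p. 11)] [cite: CossartPiltant2009, ch.1 II.5.3.2 (i)] -/
theorem sum_mul_natDegree_le_of_restriction_localization (hK : ∀ x ∈ K, φ x = 0) {U : O} {a₀ : k} (ha₀ : a₀ ≠ 0) {lam : k[X]}
    (hU : φ U = C a₀ * lam) {d : ℕ} (hdeg : lam.natDegree ≤ d) (hd : (d : k) = 0) (hlam : derivative lam ≠ 0)
    {ι : Type*} (s : Finset ι) (q : ι → Ideal O) (hq : ∀ i ∈ s, (q i).IsMaximal) (P : ι → k[X]) (e : ι → ℕ)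
    (hP : ∀ i ∈ s, Prime (P i)) (hne : ∀ i ∈ s, ∀ j ∈ s, i ≠ j → ¬ P i ∣ P j) (hqP : ∀ i ∈ s, ∀ x ∈ q i, φ x ∈ Ideal.span {P i})
    (Oi : ι → Type*) [∀ i, CommRing (Oi i)] [∀ i, Algebra O (Oi i)] [∀ i, CharP (Oi i) p]
    (hloc : ∀ i ∈ s, ∀ _ : (q i).IsMaximal, IsLocalization.AtPrime (Oi i) (q i))
    (h : ∀ i ∈ s, ∃ c' : Oi i,
      algebraMap O (Oi i) U - c' ^ p ∈ K.map (algebraMap O (Oi i)) ⊔ ((q i).map (algebraMap O (Oi i))) ^ (e i + 1)) :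
    ∑ i ∈ s, e i * (P i).natDegree ≤ d - 2 := by
  have hDF : (derivative' : Derivation k k[X] k[X]) (φ U) ≠ 0 := by
    rw [hU]; exact derivative'_C_mul_ne_zero ha₀ hlam
  refine (sum_mul_natDegree_le_of_sub_pow_mem_localization p φ K hK _ hDF s q hq P e hP hne hqP Oi hloc h).trans ?_
  rw [hU]
  exact natDegree_derivative'_C_mul_le ha₀ hdeg hd

/-- In particular the NUMBER of obstruction points on `Γ″` with `ν ≥ 2` (each `e_i ≥ 1`, `deg P_i ≥ 1`) is at most `d − 2`. [cite: CossartPiltant2008, Prop. 4.4 (proof, p. 11)] -/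
theorem card_le_of_restriction (hK : ∀ x ∈ K, φ x = 0) {U : O} {a₀ : k} (ha₀ : a₀ ≠ 0) {lam : k[X]} (hU : φ U = C a₀ * lam)
    {d : ℕ} (hdeg : lam.natDegree ≤ d) (hd : (d : k) = 0) (hlam : derivative lam ≠ 0)
    {ι : Type*} (s : Finset ι) (q : ι → Ideal O) (P : ι → k[X])
    (hP : ∀ i ∈ s, Prime (P i)) (hne : ∀ i ∈ s, ∀ j ∈ s, i ≠ j → ¬ P i ∣ P j) (hqP : ∀ i ∈ s, ∀ x ∈ q i, φ x ∈ Ideal.span {P i})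
    (h : ∀ i ∈ s, ∃ c : O, U - c ^ p ∈ K ⊔ q i ^ 2) :
    s.card ≤ d - 2 := by
  have key := sum_mul_natDegree_le_of_restriction p φ K hK ha₀ hU hdeg hd hlam s q P (fun _ => 1) hP hne hqP
    (fun i hi => by simpa using h i hi)
  simp only [one_mul] at key
  refine le_trans ?_ key
  rw [Finset.card_eq_sum_ones]
  refine Finset.sum_le_sum fun i hi => ?_
  have h1 : (P i).natDegree ≠ 0 := fun h0 => by
    have := (hP i hi).not_unit
    rw [Polynomial.eq_C_of_natDegree_eq_zero h0] at this
    apply this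
    refine (isUnit_iff_ne_zero.mpr ?_).map C
    intro hc
    apply (hP i hi).ne_zero
    rw [Polynomial.eq_C_of_natDegree_eq_zero h0, hc, C_0]
  omega

end Count

/-! ## §4 All at once, and the `p`-th power case -/

/-- **THE BIRTHS ON THE SUCCESSOR OF A SOLVABLE FACE, ASSEMBLED** (memo 4e §2.5 «THE BIRTHS on `Γ″`» + «DEGREE COUNT», g20 recipe (3) + (5)).  From the face
data (`Φ ∈ κ[u][T]`, `deg_T Φ ≤ μ`, top coefficient the constant `c ≠ 0`, `deg_u Φ_0 ≤ μ·d`, a non-unit `π` with `π^μ ∣ Φ` — a curve of the last exceptional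
divisor along which the transform keeps order `μ` —, `p ∣ d`): the successor is `Γ″ = V(T + λ)` (`π = a(T + λ)`, `Φ = c(T + λ)^μ`, `deg λ ≤ d`), and for EVERY
restriction map `φ : O → κ[u]` killing the ideal `K` of `Γ″` with `φ U = a₀·λ` (`a₀ ≠ 0`) and every finite family of pairwise distinct closed points `P_i` with
birth orders `ν_i ≥ e_i + 1` measured upstairs: `λ′ ≠ 0 → Σ_i e_i·deg P_i ≤ d − 2`.
[cite: CossartPiltant2008, Lemma 4.3 (4)–(5); Prop. 4.4 (proof, p. 11)] [cite: CossartPiltant2009, ch.1 II.5.3.2 (i)] -/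
theorem births_on_successor_le (p : ℕ) [Fact p.Prime] [CharP k p] {Φ π : (k[X])[X]} {μ : ℕ} (hμ : 1 ≤ μ)
    (hdeg : Φ.natDegree ≤ μ) {c : k} (hc : c ≠ 0) (htop : Φ.coeff μ = C c) (hπ : ¬ IsUnit π) (hdvd : π ^ μ ∣ Φ) {d : ℕ}
    (hC0 : (Φ.coeff 0).natDegree ≤ μ * d) (hd : (d : k) = 0) :
    ∃ (a : k) (lam : k[X]), a ≠ 0 ∧ π = C (C a) * (X + C lam) ∧ Φ = C (C c) * (X + C lam) ^ μ ∧ lam.natDegree ≤ d ∧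
      ∀ {O : Type*} [CommRing O] (φ : O →+* k[X]) (K : Ideal O), (∀ x ∈ K, φ x = 0) →
      ∀ (U : O) (a₀ : k), a₀ ≠ 0 → φ U = C a₀ * lam →
      ∀ {ι : Type*} (s : Finset ι) (q : ι → Ideal O) (P : ι → k[X]) (e : ι → ℕ),
        (∀ i ∈ s, Prime (P i)) → (∀ i ∈ s, ∀ j ∈ s, i ≠ j → ¬ P i ∣ P j) → (∀ i ∈ s, ∀ x ∈ q i, φ x ∈ Ideal.span {P i}) →
        (∀ i ∈ s, ∃ c' : O, U - c' ^ p ∈ K ⊔ q i ^ (e i + 1)) →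
        derivative lam ≠ 0 → ∑ i ∈ s, e i * (P i).natDegree ≤ d - 2 := by
  obtain ⟨a, lam, ha, hπeq, hΦ, hlam, -⟩ := exists_successor_of_solvableFace hμ hdeg hc htop hπ hdvd hC0 hd
  refine ⟨a, lam, ha, hπeq, hΦ, hlam, ?_⟩
  intro O _ φ K hK U a₀ ha₀ hU ι s q P e hP hne hqP h hlam'
  exact sum_mul_natDegree_le_of_restriction p φ K hK ha₀ hU hlam hd hlam' s q P e hP hne hqP h

/-- **The `p`-th power case over a perfect residue field** (memo 4e §2.5 «if `L_rep` is NOT p-prepared … `λ ∈ κ[u]^p`, `dλ = 0`: `Γ″` is `W`-invariant … NO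
birth»): `λ′ = 0` over a perfect `κ` ⟹ the restricted unit `a₀·λ` IS a `p`-th power `G^p` in `κ[u]`, hence `φU·1^p + (−G)^p ∈ I^n` for every ideal `I` and every
`n` — no point of `Γ″` is an obstruction point of finite birth order.  (The imperfect corner `λ′ = 0`, `a₀λ ∉ κ[u]^p` is (B5′), ✓ `…ConstantTypeBirthWitness`.)
[cite: CossartPiltant2008, Prop. 4.4 (proof, p. 11)] -/
theorem exists_eq_pow_of_restriction_of_derivative_eq_zero (p : ℕ) [Fact p.Prime] [CharP k p] [PerfectRing k p]
    {O : Type*} [CommRing O] (φ : O →+* k[X]) {U : O} {a₀ : k} {lam : k[X]} (hU : φ U = C a₀ * lam)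
    (hlam : derivative lam = 0) :
    ∃ G : k[X], φ U = G ^ p ∧ ∀ (I : Ideal k[X]) (n : ℕ), φ U * 1 ^ p + (-G) ^ p ∈ I ^ n := by
  have hD : derivative (C a₀ * lam) = 0 := by rw [derivative_C_mul, hlam, mul_zero]
  obtain ⟨G, hG⟩ := exists_eq_pow_of_derivative_eq_zero p hD
  refine ⟨G, by rw [hU, hG], fun I n => ?_⟩
  exact sub_pow_mem_pow_of_eq_pow p (by rw [hU, hG]) I n

/-! ## Appended (hand-2 g21): `π^μ ∣ Φ` read in the local ring of `E` at the generic point of `Γ″` -/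

/-- **From the local ring of the exceptional divisor at the generic point of `Γ″`**: `S′` a localization of the domain `R` (`= κ[u][T]`, the chart of `E`) at
the height-one prime `(π)` (`π` a prime element: the equation of the integral curve `Γ″` on the chart), `Φ ∈ 𝔪_{S′}^n` («the face has order `≥ n` along `Γ″`»,
the restriction to `E` of «the transform keeps order `μ` along the near curve `Γ″`») ⟹ `π^n ∣ Φ` in `R` — the hypothesis `hdvd` of ✓ `births_on_successor_le`.
[folklore] -/
theorem pow_dvd_of_mem_maximalIdeal_pow_atPrime {R S' : Type*} [CommRing R] [IsDomain R] [CommRing S'] [Algebra R S'] {π : R}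
    (hπ : Prime π) [(Ideal.span {π}).IsPrime] [IsLocalRing S'] [IsLocalization.AtPrime S' (Ideal.span {π})] {Φ : R} {n : ℕ}
    (h : algebraMap R S' Φ ∈ IsLocalRing.maximalIdeal S' ^ n) : π ^ n ∣ Φ := by
  have hmax : IsLocalRing.maximalIdeal S' = (Ideal.span {π}).map (algebraMap R S') :=
    (IsLocalization.AtPrime.map_eq_maximalIdeal (Ideal.span {π}) S').symm
  rw [hmax, ← Ideal.map_pow, Ideal.span_singleton_pow, Ideal.map_span, Set.image_singleton, Ideal.mem_span_singleton,
    map_pow] at h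
  refine pow_dvd_of_pow_dvd_algebraMap (Ideal.span {π}).primeCompl (Ideal.primeCompl_le_nonZeroDivisors _) hπ
    (fun m hm hdvd => ?_) h
  exact hm (Ideal.mem_span_singleton.mpr hdvd)

end Summit.ResolutionOfSingularities.ResolutionOfSingularities.Theorems.RadicialJung.CleanModels

end
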